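import Literature.Computability.Complexity.CodeFPListKit
import Literature.Computability.Complexity.CodeFPBudgets
import Literature.Computability.Complexity.CodeFPLists
import Literature.Computability.Complexity.CodeFPStringKit
import Literature.Computability.Complexity.CodeFPStrings
import Literature.Computability.Complexity.CodeFPArith
import Literature.Computability.Complexity.CookBridges
import Summits.PneNP.PneNP.Theorems.LocalMapDecodeFP
import Summits.PneNP.PneNP.Theorems.PstarTypedDouble
import Summits.PneNP.PneNP.Theorems.PstarTyped
import Literature.Computability.Complexity.LocalAvoidAlgorithms

/-!
# Pure `P⋆` maps: the typed reduction in polynomial time — THE ROOF IS ITS TYPED CASE (T20.3)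

FRONTIER range-avoidance ladder, roof F-N3 `PstarIsolation.PstarAvoidLinearFP` (restricted-model algorithmics —
nothing here bears on `P` vs `NP`).  Cell `pnp-ideate`, ROUND-20 SEED §2, target T20.3.

`PstarTypedDouble` shows `Range f ⊆ Range f̃` for the typed double `f̃ = typedDouble f` on `n + n` inputs.  This file
types the re-indexing `encode f ↦ encode f̃` in the tree's `CodeFP` algebra — decode (`LocalMapDecodeFP.decode`), shift
the AND positions of every block by `n` (positions capped at the unary budget `n = hdrN w`, so all unary conversions
are polynomial), re-assemble with header `1^{2n} 0 · 1^m 0` (`dblCode`, `dblCode_outsOf`) — and composes it with a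
hypothesised polynomial-time avoider `f₀` of the TYPED class (`dblStr f₀`, `isPolyTime_dblStr`).  Hence

  `pstarAvoid_of_typedAvoid : PstarTypedAvoidLinearFP → PstarAvoidLinearFP`   (stretch constant `C ↦ 2C`),

and with the trivial converse `PstarTypedDouble.typedAvoid_of_pstarAvoid`:
`pstarAvoid_iff_typedAvoid : PstarAvoidLinearFP ↔ PstarTypedAvoidLinearFP` — range avoidance at linear stretch for
pure `P⋆` maps is in FP iff it is for the TYPED pure `P⋆` maps (XOR variables disjoint from AND variables).

CANONICAL NAMES.  The planner's file `PstarTyped` (landed in parallel with `PstarTypedDouble`) carries the canonical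
typed class `PstarTyped.TypedPstar` and double `PstarTyped.typedDouble`; the last section identifies the two
(`typedDouble_eq_canonical : PstarTypedDouble.typedDouble I = PstarTyped.typedDouble I` by `rfl`,
`typedPure_iff_typedPstar`) and restates the transfer over the canonical class
(`pstarAvoid_of_typedPstarAvoid`, `pstarAvoid_iff_typedPstarAvoid`).
-/

set_option linter.dupNamespace false

namespace Summit.PneNP.PneNP.Theorems.PstarTypedDoubleFP

open Literature.Computability.Complexity
open Summit.PneNP.PneNP.Theorems.PstarTypedDouble
open Summit.PneNP.PneNP.Theorems.LocalMapDecodeFP (decode hdrN outE codeFP_decode codeFP_hdrN tabOf blockOf posCode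
  outsOf decode_encode hdrN_encode encode_eq)
open Summit.PneNP.PneNP.Theorems.MajLocalAvoidFP (rowOf length_rowOf)

variable {n m : ℕ}

/-! ## The re-indexing machine -/

/-- The doubled position of slot number `i` holding variable `v`, against the unary budget `N` (`= n` on genuine
codes): XOR slots (`i < 2`) keep `v`, AND slots get `N + v`; `v` is capped at `N` so that unary conversion is cheap. -/
def dshift (N i v : ℕ) : ℕ := (if i < 2 then 0 else N) + min v N

/-- The code block of a decoded output, rebuilt with doubled positions. -/
def dblk (N : ℕ) (o : List Bool × List ℕ) : List Bool :=
  o.1 ++ (o.2.mapIdx fun i v => LocalMap.unaryCode (dshift N i v)).flatten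

/-- The code of the typed double, assembled from the decoded outputs: header `1^{N+N}0 · 1^{#outs}0`, then blocks. -/
def dblCode (N : ℕ) (outs : List (List Bool × List ℕ)) : List Bool :=
  LocalMap.unaryCode (N + N) ++ LocalMap.unaryCode outs.length ++ (outs.map (dblk N)).flatten

/-- **THE AVOIDER** `dblStr f₀`: run the typed avoider `f₀` on the code of the typed double. -/
def dblStr (f₀ : List Bool → List Bool) (w : List Bool) : List Bool := f₀ (dblCode (hdrN w) (decode 4 w))

/-! ## Semantics on genuine codes -/

/-- The tables of the double are the tables of the instance. -/
theorem tabOf_typedDouble (I : LocalMap 4 n m) (j : Fin m) : tabOf (typedDouble I) j = tabOf I j := rfl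

/-- Rebuilding the positions of a genuine output gives the positions of the double. -/
theorem mapIdx_rowOf (I : LocalMap 4 n m) (j : Fin m) :
    (rowOf I j).mapIdx (fun i v => LocalMap.unaryCode (dshift n i v)) =
      (rowOf (typedDouble I) j).map LocalMap.unaryCode := by
  apply List.ext_getElem
  · simp [rowOf]
  · intro i h₁ h₂
    rw [List.getElem_mapIdx, List.getElem_map]
    have hi : i < 4 := by simpa [rowOf] using h₂
    simp only [rowOf, List.getElem_ofFn, typedDouble, dvar_val, IsXorSlot, dshift]
    congr 1
    have hv := (I.vars j ⟨i, hi⟩).isLt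
    rw [min_eq_left hv.le]
    split_ifs <;> omega

/-- Rebuilding the block of a genuine output gives the code block of the double. -/
theorem dblk_out (I : LocalMap 4 n m) (j : Fin m) : dblk n (tabOf I j, rowOf I j) = blockOf (typedDouble I) j := by
  unfold dblk
  rw [blockOf, tabOf_typedDouble, posCode, mapIdx_rowOf]

/-- **On a genuine code the machine assembles the code of the typed double.** -/
theorem dblCode_outsOf (I : LocalMap 4 n m) : dblCode n (outsOf I) = (typedDouble I).encode := by
  rw [encode_eq (typedDouble I), dblCode, outsOf, List.length_map, List.length_finRange, List.map_map]
  congr 2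
  exact List.map_congr_left fun j _ => dblk_out I j

/-- **What the avoider computes on a genuine code**: `f₀` on the code of the typed double. -/
theorem dblStr_encode (f₀ : List Bool → List Bool) (I : LocalMap 4 n m) :
    dblStr f₀ I.encode = f₀ (typedDouble I).encode := by
  rw [dblStr, hdrN_encode, decode_encode, dblCode_outsOf]

/-! ## Polynomial time -/

section PolyTime

open CodeFP

/-- The doubled position, in unary, is polynomial time (context: the unary budget `N`; data: slot number, value). -/
theorem codeFP_dshift : CodeFP (pairE unE (pairE natE natE)) unE (fun t => dshift t.1 t.2.1 t.2.2) := by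
  have hmin : CodeFP (pairE unE (pairE natE natE)) unE (fun t => min t.2.2 t.1) :=
    (unOfNatMin.comp ((fst unE (pairE natE natE)).pair (snd unE (pairE natE natE)).snd')).congr fun _ => rfl
  have hc : CodeFP (pairE unE (pairE natE natE)) bitE (fun t => decide (t.2.1 < 2)) :=
    (natLt.comp ((snd unE (pairE natE natE)).fst'.pair (const _ (2 : ℕ)))).congr fun _ => rfl
  have hoff : CodeFP (pairE unE (pairE natE natE)) unE (fun t => if decide (t.2.1 < 2) then 0 else t.1) :=
    hc.ite (const _ (0 : ℕ)) (fst unE (pairE natE natE))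
  exact (unAdd.comp (hoff.pair hmin)).congr fun t => by
    by_cases h : t.2.1 < 2 <;> simp [dshift, h]

/-- A unary numeral's self-delimiting code, then the rebuilt block, are polynomial time. -/
theorem codeFP_dblk : CodeFP (pairE unE outE) strE (fun p => dblk p.1 p.2) := by
  have hU : CodeFP unE strE LocalMap.unaryCode :=
    (strAppend.comp (strOfUn.pair (const unE [false]))).congr fun a => by
      show unE a ++ [false] = LocalMap.unaryCode a
      rw [unE_eq_ones]; rfl
  have hg : CodeFP (pairE unE (pairE natE natE)) strE (fun t => LocalMap.unaryCode (dshift t.1 t.2.1 t.2.2)) :=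
    (hU.comp codeFP_dshift).congr fun _ => rfl
  have hpos : CodeFP (pairE unE outE) strE
      (fun p => (p.2.2.mapIdx fun i v => LocalMap.unaryCode (dshift p.1 i v)).flatten) :=
    (strFlatten.comp ((mapIdx hg).comp ((fst unE outE).pair (snd unE outE).snd'))).congr fun _ => rfl
  exact (strAppend.comp ((snd unE outE).fst'.pair hpos)).congr fun _ => rfl

/-- Assembling the code of the typed double is polynomial time. -/
theorem codeFP_dblCode : CodeFP (pairE unE (rawE outE)) strE (fun p => dblCode p.1 p.2) := by
  have hU : CodeFP unE strE LocalMap.unaryCode :=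
    (strAppend.comp (strOfUn.pair (const unE [false]))).congr fun a => by
      show unE a ++ [false] = LocalMap.unaryCode a
      rw [unE_eq_ones]; rfl
  have hN2 : CodeFP (pairE unE (rawE outE)) strE (fun p => LocalMap.unaryCode (p.1 + p.1)) :=
    (hU.comp (unAdd.comp ((fst unE (rawE outE)).pair (fst unE (rawE outE))))).congr fun _ => rfl
  have hlen : CodeFP (pairE unE (rawE outE)) unE (fun p => p.2.length) :=
    ((ulength outE).comp (snd unE (rawE outE))).congr fun _ => rfl
  have hM : CodeFP (pairE unE (rawE outE)) strE (fun p => LocalMap.unaryCode p.2.length) :=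
    (hU.comp hlen).congr fun _ => rfl
  have hbl : CodeFP (pairE unE (rawE outE)) strE (fun p => (p.2.map (dblk p.1)).flatten) :=
    (strFlatten.comp ((map codeFP_dblk).comp ((fst _ _).pair (snd _ _)))).congr fun _ => rfl
  exact (strAppend.comp ((strAppend.comp (hN2.pair hM)).pair hbl)).congr fun _ => rfl

/-- **The avoider is computed on codes in polynomial time**, relative to a polynomial-time `f₀`. -/
theorem codeFP_dblStr {f₀ : List Bool → List Bool} (hf₀ : IsPolyTime f₀) : CodeFP strE strE (dblStr f₀) := by
  have hF : CodeFP strE strE f₀ := of_fn f₀ ((CookBridges.isPolyTime_iff f₀).1 hf₀) fun _ => rfl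
  exact (hF.comp (codeFP_dblCode.comp (codeFP_hdrN.pair (codeFP_decode 4)))).congr fun _ => rfl

/-- **`dblStr f₀` is polynomial-time computable** (`IsPolyTime`) whenever `f₀` is. -/
theorem isPolyTime_dblStr {f₀ : List Bool → List Bool} (hf₀ : IsPolyTime f₀) : IsPolyTime (dblStr f₀) := by
  obtain ⟨f, hf, hfw⟩ := codeFP_dblStr hf₀
  have h : f = dblStr f₀ := funext fun w => hfw w
  rw [h] at hf
  exact (CookBridges.isPolyTime_iff _).2 hf

end PolyTime

/-! ## The transfer -/

/-- **T20.3 — the typed reduction**: an FP range-avoider at linear stretch for the TYPED pure `P⋆` maps (constant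
`C₀`, one polynomial-time `f₀`) yields one for ALL pure `P⋆` maps (constant `2·C₀`, the one polynomial-time function
`dblStr f₀`): on an instance with `n` inputs and `m ≥ 2C₀·n` outputs, run `f₀` on its typed double (`n + n` inputs,
same `m` outputs); the answer avoids the double's range, which contains the instance's range. -/
theorem pstarAvoid_of_typedAvoid : PstarTypedAvoidLinearFP → PstarIsolation.PstarAvoidLinearFP := by
  rintro ⟨C₀, f₀, hf₀, hspec⟩
  refine ⟨2 * C₀, dblStr f₀, isPolyTime_dblStr hf₀, fun n m I hI hn hm => ?_⟩
  rw [dblStr_encode]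
  exact not_mem_range_of_typedDouble I _
    (hspec (n + n) m (typedDouble I) (typedPure_typedDouble I hI) (by omega) (by
      have : C₀ * (n + n) = 2 * C₀ * n := by ring
      omega))

/-- **THE ROOF IS ITS TYPED CASE**: pure `P⋆` range avoidance at linear stretch is in FP iff it is in FP for the typed
pure `P⋆` maps. -/
theorem pstarAvoid_iff_typedAvoid : PstarIsolation.PstarAvoidLinearFP ↔ PstarTypedAvoidLinearFP :=
  ⟨typedAvoid_of_pstarAvoid, pstarAvoid_of_typedAvoid⟩

/-! ## The transfer over the planner's canonical typed class `PstarTyped.TypedPstar` -/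

/-- The two typed doubles coincide (same positions: XOR slots on the left copy, AND slots on the right copy). -/
theorem typedDouble_eq_canonical (I : LocalMap 4 n m) : typedDouble I = PstarTyped.typedDouble I := rfl

/-- The two typed promise classes coincide. -/
theorem typedPure_iff_typedPstar (I : LocalMap 4 n m) : TypedPure I ↔ PstarTyped.TypedPstar I := by
  constructor
  · rintro ⟨hp, ht⟩
    exact ⟨hp, fun j j' s t hs ht' => ht j j' s t hs (Nat.not_lt.2 ht')⟩
  · rintro ⟨hp, ht⟩
    exact ⟨hp, fun j j' s t hs ht' => ht j j' s t hs (Nat.not_lt.1 ht')⟩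

/-- The typed rung over either class is the same statement. -/
theorem pstarTypedAvoidLinearFP_iff_canonical :
    PstarTypedAvoidLinearFP ↔ LocalAvoidLinearFP 4 PstarTyped.TypedPstar :=
  ⟨LocalAvoidLinearFP.anti fun _ _ I h => (typedPure_iff_typedPstar I).2 h,
    LocalAvoidLinearFP.anti fun _ _ I h => (typedPure_iff_typedPstar I).1 h⟩

/-- **T20.3 over the canonical class**: an FP range-avoider at linear stretch for `PstarTyped.TypedPstar` yields one
for all pure `P⋆` maps (`C ↦ 2C`, avoider `dblStr f₀`). -/
theorem pstarAvoid_of_typedPstarAvoid :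
    LocalAvoidLinearFP 4 PstarTyped.TypedPstar → PstarIsolation.PstarAvoidLinearFP :=
  fun h => pstarAvoid_of_typedAvoid (pstarTypedAvoidLinearFP_iff_canonical.2 h)

/-- **THE ROOF IS ITS TYPED CASE** (canonical class): `PstarAvoidLinearFP ↔ LocalAvoidLinearFP 4 PstarTyped.TypedPstar`. -/
theorem pstarAvoid_iff_typedPstarAvoid :
    PstarIsolation.PstarAvoidLinearFP ↔ LocalAvoidLinearFP 4 PstarTyped.TypedPstar :=
  pstarAvoid_iff_typedAvoid.trans pstarTypedAvoidLinearFP_iff_canonical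

end Summit.PneNP.PneNP.Theorems.PstarTypedDoubleFP
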